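import Summits.AtomisticToContinuum.HydrodynamicLimit.Theses.OneFlightGossipEngine
import HarnessLib

/-!
# Definitions of line `Sketch` (card `euler-gauged-bobylev-summation`, truncated) of crux
# `SuperExponentialEnergyTails` (stmt-AtomisticToContinuum-17701)

Support file (`--supports stmt-AtomisticToContinuum-17701`) of the registered skeleton
`Cruxes/SuperExponentialEnergyTails/Lines/Sketch.lean` (lead
prover-line-stmt-AtomisticToContinuum-17701-0): the two route-internal propositions quoted by the
transfer stubs of the line.

* `VelocityMomentHierarchy` — the **velocity moment hierarchy of Gaussian class, `k`-wise in `N`**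
  under the TRUE pre-shock law: in the frame of the crux (continuous profiles, `∃ σ₀ ∀ σ < σ₀`,
  classical hs-Euler solution on `[0,T)`, flow family, law-of-large-numbers tie at `t = 0`,
  `t < T`) there are `A, C > 0` such that for EVERY order `k` there is `N₀(k)` with
  `E_{λ₀}[(N+1)⁻¹ ∑ᵢ ‖vᵢ(s)‖^{2k}] ≤ C Aᵏ k!` for all `N ≥ N₀(k)` and `s ∈ [0, t]`.
  The threshold `N₀` is allowed to depend on the order `k` (this is what a moment summation
  TRUNCATED at an `N`-dependent order delivers); the constants `A, C` are not.  It implies the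
  crux (stub `stub_seetOfVelocityHierarchy`: choose the order `k ≍ K²/A` after the level `K`,
  then `N₀(k)`; the slack `ε` of the crux is not even used), and it is implied by a Gaussian
  velocity moment bound uniform in `N` (Nachtergaele–Yau's `HighMomentumCutoff`), but not
  conversely.
* `GaugedMomentHierarchy` — the same hierarchy for the **Euler-gauged energies**
  `êᵢ(s) = ‖vᵢ(s) − u(s, xᵢ(s))‖² / θ(s, xᵢ(s))` (kinetic energy in local thermal units of the
  classical Euler solution of the frame).  Pre-shock `θ ≤ Θ̄` and `‖u‖ ≤ U` on `[0,t] × 𝕋³`, so it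
  implies `VelocityMomentHierarchy` with `(A, C) ↦ (4Θ̄A + 4U², C + 1)` (stub
  `stub_velocityOfGaugedHierarchy`); it is the output of the truncated Euler-gauged
  Bobylev–Gamba–Panferov–Villani summation the line drives (stub `stub_gaugedMomentHierarchy`).

Route-internal propositions in the vocabulary of the crux (prelude notions `T3`, `V3`,
`hsDiameter`, `localGibbsLaw`, `HardSphereFlow`, `IsHardSphereEulerSolution`,
`TendstoHydroFieldsAt` only), not cited facts; no new objects.
-/

noncomputable section

namespace Summit.AtomisticToContinuum.HydrodynamicLimit.Theorems.SuperExponentialEnergyTailsLine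

open scoped BigOperators ENNReal
open MeasureTheory Set
open Literature.MathematicalPhysics.KineticTheory Literature.Analysis.FluidPDE

/-- **`VelocityMomentHierarchy` (C⁺ of line Sketch, crux SuperExponentialEnergyTails; true law,
fixed-time marginals, `k`-wise in `N`).**  In the frame of the crux: for every `t < T` there are
`A, C > 0` such that for every order `k : ℕ` there is `N₀` with
`∫ (N+1)⁻¹ ∑ᵢ (‖vᵢ(Φ_N(s) z)‖²)ᵏ dλ^N_{σ,a₀,u₀,θ₀}(z) ≤ C · Aᵏ · k!` for all `N ≥ N₀` and all
`s ∈ [0, t]` — Gaussian-class growth of the empirical even velocity moments under the true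
evolved law, the threshold in `N` depending on the order.  Route-internal proposition of line
Sketch (registered stub signatures `stub_seetOfVelocityHierarchy`,
`stub_velocityOfGaugedHierarchy`), not a cited fact. -/
def VelocityMomentHierarchy : Prop :=
  ∀ (a₀ θ₀ : T3 → ℝ) (u₀ : T3 → V3), Continuous a₀ → Continuous θ₀ → Continuous u₀ →
    (∀ x, 0 < a₀ x) → (∀ x, 0 < θ₀ x) →
    ∃ σ₀ : ℝ, 0 < σ₀ ∧ ∀ σ : ℝ, 0 < σ → σ < σ₀ →
      ∀ (T : ℝ) (ρ θ : ℝ → T3 → ℝ) (u : ℝ → T3 → V3), IsHardSphereEulerSolution σ T ρ u θ →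
        ∀ Φ : (N : ℕ) → HardSphereFlow (Torus.geometry (Fin 3)) (hsDiameter σ N) (N + 1),
          TendstoHydroFieldsAt (fun N => localGibbsLaw σ a₀ u₀ θ₀ N (Φ N)) Φ ρ u θ 0 →
            ∀ t ∈ Set.Ico 0 T, ∃ A : ℝ, 0 < A ∧ ∃ C : ℝ, 0 < C ∧ ∀ k : ℕ, ∃ N₀ : ℕ, ∀ N : ℕ, N₀ ≤ N →
              ∀ s ∈ Set.Icc 0 t,
                ∫⁻ z, ENNReal.ofReal (((N : ℝ) + 1)⁻¹ * ∑ i : Fin (N + 1),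
                    (‖((Φ N).flow s z i).2‖ ^ 2) ^ k) ∂(localGibbsLaw σ a₀ u₀ θ₀ N (Φ N))
                  ≤ ENNReal.ofReal (C * A ^ k * (k.factorial : ℝ))

/-- **`GaugedMomentHierarchy` (true law, Euler gauge, `k`-wise in `N`).**  In the frame of the
crux: for every `t < T` there are `A, C > 0` such that for every order `k : ℕ` there is `N₀` with
`∫ (N+1)⁻¹ ∑ᵢ êᵢ(s)ᵏ dλ^N ≤ C · Aᵏ · k!` for all `N ≥ N₀` and `s ∈ [0, t]`, where
`êᵢ(s) = ‖vᵢ − u(s, xᵢ)‖² / θ(s, xᵢ)` is the kinetic energy of sphere `i` of `Φ_N(s) z` in the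
local thermal units of the classical Euler solution `(ρ, u, θ)` of the frame (`θ > 0` on
`[0, T) × 𝕋³`).  The output of the line's truncated gauged moment summation (registered stub
signature `stub_gaugedMomentHierarchy`); route-internal proposition of line Sketch, crux
SuperExponentialEnergyTails, not a cited fact. -/
def GaugedMomentHierarchy : Prop :=
  ∀ (a₀ θ₀ : T3 → ℝ) (u₀ : T3 → V3), Continuous a₀ → Continuous θ₀ → Continuous u₀ →
    (∀ x, 0 < a₀ x) → (∀ x, 0 < θ₀ x) →
    ∃ σ₀ : ℝ, 0 < σ₀ ∧ ∀ σ : ℝ, 0 < σ → σ < σ₀ →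
      ∀ (T : ℝ) (ρ θ : ℝ → T3 → ℝ) (u : ℝ → T3 → V3), IsHardSphereEulerSolution σ T ρ u θ →
        ∀ Φ : (N : ℕ) → HardSphereFlow (Torus.geometry (Fin 3)) (hsDiameter σ N) (N + 1),
          TendstoHydroFieldsAt (fun N => localGibbsLaw σ a₀ u₀ θ₀ N (Φ N)) Φ ρ u θ 0 →
            ∀ t ∈ Set.Ico 0 T, ∃ A : ℝ, 0 < A ∧ ∃ C : ℝ, 0 < C ∧ ∀ k : ℕ, ∃ N₀ : ℕ, ∀ N : ℕ, N₀ ≤ N →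
              ∀ s ∈ Set.Icc 0 t,
                ∫⁻ z, ENNReal.ofReal (((N : ℝ) + 1)⁻¹ * ∑ i : Fin (N + 1),
                    (‖((Φ N).flow s z i).2 - u s ((Φ N).flow s z i).1‖ ^ 2
                      / θ s ((Φ N).flow s z i).1) ^ k) ∂(localGibbsLaw σ a₀ u₀ θ₀ N (Φ N))
                  ≤ ENNReal.ofReal (C * A ^ k * (k.factorial : ℝ))

end Summit.AtomisticToContinuum.HydrodynamicLimit.Theorems.SuperExponentialEnergyTailsLine

end
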